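import Literature.NumberTheory.EllipticCurves.EichlerShimuraConstructionKernelProofs
import Literature.NumberTheory.EllipticCurves.PeriodLatticePresentationProofs
import HarnessLib

/-!
# `IsNewformOf.exists_maninConstant_ne_zero`: what remains is the Eichler–Shimura congruence
# relation for `ℂ/Λ_f` (with Deligne–Serre (2.7.2) and Faltings)

Topic `NumberTheory/EllipticCurves`; a proofs-only companion (theorems only: no definitions, no
named facts, nothing restated; D-0026) of `ModularParametrizationDegree.lean`, written by the
seat of its named fact `IsNewformOf.exists_maninConstant_ne_zero` — for an elliptic curve `W/ℚ`
whose `L`-function is that of a newform `f ∈ S₂(Γ₀(N))` (`IsNewformOf W f`) and a Néron-type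
period pair `L` of `W`, the period lattice `Λ_f` of `2πi f(τ)dτ` satisfies `c Λ_f ⊆ Λ_L` for an
integer `c ≠ 0` (Breuil–Conrad–Diamond–Taylor 2001, p. 845: "(2) ⇒ (6) follows from a
construction of Shimura [Sh2] and a theorem of Faltings [Fa1]").

State of the tree. `EichlerShimuraConstructionKernelProofs.lean` isolated the open content of
the whole "(2) ⇒ (6)" cluster (`eichlerShimuraConstruction`,
`IsNewformOf.exists_maninConstant_ne_zero`, `exists_weierstrassCurve_of_rational_isNewform0`,
`nonempty_modularParametrizationData`, and — `ModularCurveManinSemistableKernelProofs.lean` —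
`abs_maninConstant_eq_one_of_isSemistable`) in one curve-free kernel **`H`**: for a newform
`f ∈ S₂(Γ₀(N))` with `K_f = ℚ` and a period pair `L` spanning `Λ_f`,

* (H-rat) there are `a₄, a₆ ∈ ℚ` with `g₂(L) = -4a₄`, `g₃(L) = -4a₆` (Cremona 1997, §2.14: "since
  `E_f` is defined over `ℚ`, the numbers `c₄` and `c₆` are rational"; Knapp 1993, Thm. 11.74 (d)
  with the rationality of the Manin constant, Agashe–Ribet–Stein 2006, §2), and
* (H-cong) the curve `y² = x³ + a₄x + a₆` over `ℚ` — the torus `ℂ/Λ_f` with the differential `dz`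
  — has `a_p = a_p(f)` for the primes `p ∤ N` (the **Eichler–Shimura congruence relation**:
  Shimura 1971, Thm. 7.9 with Thm. 7.14–7.15; Knapp 1993, Thm. 11.74 (e) with the Remark on
  Igusa, PDF p. 287).

`PeriodLatticePresentationProofs.lean` then **proved (H-rat)** granted Deligne–Serre 1974,
(2.7.2), in the weights `k ≥ 12` (`IsNewform0.exists_rat_g₂_g₃_periodLattice`: the analytic
modular parametrisation `τ ↦ (℘_Λ(u), ℘_Λ'(u))`, `u = 2πi∫_{i∞}^τ f`, presented as a quotient of
cusp forms of weight `12m` on `Γ₁(N)`, and descent along `Aut(ℂ/ℚ)`; (2.7.2) =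
`DeligneSerre1974_span_integralLattice1 N k`, a named fact of the tree, supplies the conjugates
of those cusp forms).

This file records the effect on the cluster: **its open content is now exactly (H-cong)**, the
congruence relation for the one explicit curve `y² = x³ - (g₂(Λ_f)/4)x - g₃(Λ_f)/4`, together
with the two named facts (2.7.2) and — for the facts that conclude with a *given* curve `W` —
Faltings' isogeny theorem (`WeierstrassCurve.isIsogenous_iff_frobeniusTrace_eq`).

* `rational_invariants_of_congruence` — `H` from (2.7.2) in weights `≥ 12` and (H-cong).
* `eichlerShimuraConstruction_of_congruence` — `eichlerShimuraConstruction` from modularity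
  (`exists_isNewformOf`, for Carayol's part), (2.7.2) and (H-cong).
* `strongWeil_of_congruence` — Knapp's Thm. 11.74 (d)–(e) with the rational Manin constant (the
  statement `SW` of `rational_invariants_iff_strongWeil`) from (2.7.2) and (H-cong).
* `exists_maninConstant_ne_zero_of_congruence` — the named fact of this seat from (2.7.2),
  (H-cong) and Faltings.
* `exists_maninConstant_ne_zero_of_congruence_cofinite` — the same with (H-cong) weakened to
  the form Shimura prints (Thm. 7.15: the zeta function of the curve "coincides, up to a finite
  number of Euler factors, with" `L(s, f)`): **`a_p(ℂ/Λ_f) = a_p(f)` for all but finitely many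
  `p`** suffices for this fact, because Faltings' criterion only needs almost all `p`
  (`WeierstrassCurve.isIsogenous_of_finite_setOf_LFunction_ne`). This is the sharpest honest
  reduction of `IsNewformOf.exists_maninConstant_ne_zero` available in the tree: beyond the
  named facts `DeligneSerre1974_span_integralLattice1` (weights `≥ 12`) and
  `isIsogenous_iff_frobeniusTrace_eq`, what a discharge must supply is the cofinite congruence
  relation for `ℂ/Λ_f`, and nothing else.

Why (H-cong) is not attempted here: every printed proof reduces `X₀(N)` or `J₀(N)` modulo `p`
(Eichler 1954, Shimura 1958 and 1971 §7.2–7.4, Igusa 1959; Deligne–Rapoport; Conrad's appendix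
to Agashe–Ribet–Stein) — the modular curve as a curve over `ℚ` with good reduction at `p ∤ N`
and the moduli interpretation of `T_p`, none of which the tree has; and no characteristic-zero
substitute is known (comparing `L(W ⊗ χ, 1)` with periods of `W` is itself a consequence of a
modular parametrisation of `W` over `ℚ`). Nothing is discharged; no statement of the tree is
changed; no definition and no named fact is added.

## References

* C. Breuil, B. Conrad, F. Diamond, R. Taylor, *On the modularity of elliptic curves over `ℚ`:
  wild 3-adic exercises*, J. Amer. Math. Soc. 14 (2001), 843–939: Thm. A; p. 845, "(2) ⇒ (6)".
  [BCDTJAMS2001]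
* G. Shimura, *Introduction to the arithmetic theory of automorphic functions*, Princeton 1971:
  Thm. 7.9, Thm. 7.14, Thm. 7.15 (PDF p. 212). [ShimuraIATAF1971]
* A. W. Knapp, *Elliptic Curves*, Math. Notes 40, Princeton 1993: Thm. 11.74 (d), (e) with the
  Remarks following it (PDF p. 287); Thm. 12.8 (PDF p. 301); PDF p. 302. [Knapp1993]
* J. E. Cremona, *Algorithms for Modular Elliptic Curves*, 2nd ed., CUP 1997: §2.14
  (pp. 33–34). [CremonaAlgorithms1997]
* A. Agashe, K. Ribet, W. A. Stein, *The Manin constant*, Pure Appl. Math. Q. 2 (2006), 617–636: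
  §2. [AgasheRibetStein2006]
* P. Deligne, J.-P. Serre, *Formes modulaires de poids 1*, Ann. Sci. ÉNS 7 (1974): Prop. 2.7,
  (2.7.2). [DeligneSerreASENS1974]
* G. Faltings, *Endlichkeitssätze für abelsche Varietäten über Zahlkörpern*, Invent. Math. 73
  (1983): §5, Korollar 2. [Faltings1983Endlichkeit]
-/

noncomputable section

open scoped MatrixGroups ModularForm Pointwise

open CongruenceSubgroup UpperHalfPlane PowerSeries

namespace Literature.NumberTheory.EllipticCurves.ModularForms

/-! ### The kernel `H` from Deligne–Serre (2.7.2) and the congruence relation -/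

/-- **The curve-free kernel `H` from (2.7.2) and the Eichler–Shimura congruence relation.**
Hypotheses: `hDS` — Deligne–Serre 1974, (2.7.2), at every level in the weights `k ≥ 12` (the
tree's named fact `DeligneSerre1974_span_integralLattice1 N k`); `hC` — for every newform
`f ∈ S₂(Γ₀(N))` with `K_f = ℚ`, every period pair `L` spanning `Λ_f` and all `a₄, a₆ ∈ ℚ` with
`g₂(L) = -4a₄`, `g₃(L) = -4a₆`, the curve `y² = x³ + a₄x + a₆` has `a_p = a_p(f)` for the primes
`p ∤ N` (Knapp 1993, Thm. 11.74 (e) with the Remark on Igusa; for this model of `ℂ/Λ_f` by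
Thm. 11.74 (d) and the rationality of the Manin constant, cf.
`rational_invariants_iff_strongWeil`). Conclusion: the kernel `H` of
`EichlerShimuraConstructionKernelProofs.lean` — the rational `a₄, a₆` exist by
`IsNewform0.exists_rat_g₂_g₃_periodLattice` (`PeriodLatticePresentationProofs.lean`).
[cite: Knapp1993, Thm. 11.74 (d), (e) with Remarks (PDF p. 287)]
[cite: CremonaAlgorithms1997, §2.14 (pp. 33–34)] -/
theorem rational_invariants_of_congruence
    (hDS : ∀ (N : ℕ) [NeZero N] (k : ℤ), 12 ≤ k → DeligneSerre1974_span_integralLattice1 N k)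
    (hC : ∀ (N : ℕ) [NeZero N] (f : CuspForm (Gamma0 N) 2), IsNewform0 f → coeffField f = ⊥ →
      ∀ (L : PeriodPair), L.lattice.toAddSubgroup = periodLattice f →
        ∀ a₄ a₆ : ℚ, L.g₂ = -4 * (a₄ : ℂ) → L.g₃ = -4 * (a₆ : ℂ) →
          ∀ p : ℕ, p.Prime → ¬ p ∣ N →
            (qExpansion 1 ⇑f).coeff p =
              (({ a₁ := 0, a₂ := 0, a₃ := 0, a₄ := a₄, a₆ := a₆ } : WeierstrassCurve ℚ).LFunction
                p : ℂ))
    (N : ℕ) [NeZero N] (f : CuspForm (Gamma0 N) 2) (hf : IsNewform0 f) (hQ : coeffField f = ⊥)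
    (L : PeriodPair) (hL : L.lattice.toAddSubgroup = periodLattice f) :
    ∃ a₄ a₆ : ℚ, L.g₂ = -4 * (a₄ : ℂ) ∧ L.g₃ = -4 * (a₆ : ℂ) ∧
      ∀ p : ℕ, p.Prime → ¬ p ∣ N →
        (qExpansion 1 ⇑f).coeff p =
          (({ a₁ := 0, a₂ := 0, a₃ := 0, a₄ := a₄, a₆ := a₆ } : WeierstrassCurve ℚ).LFunction p
            : ℂ) := by
  obtain ⟨a₄, a₆, h₂, h₃⟩ := hf.exists_rat_g₂_g₃_periodLattice hQ L hL (hDS N)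
  exact ⟨a₄, a₆, h₂, h₃, hC N f hf hQ L hL a₄ a₆ h₂ h₃⟩

/-- **`eichlerShimuraConstruction` from modularity, (2.7.2) and the congruence relation**
(`rational_invariants_of_congruence` with `eichlerShimuraConstruction_of_rational_invariants`;
modularity, `exists_isNewformOf`, enters only for Carayol's part `aₙ(f) = aₙ(E)` for *all* `n`).
[cite: Knapp1993, Thm. 11.74 with Remarks (PDF p. 287) and Thm. 12.8 (PDF p. 301)] -/
theorem eichlerShimuraConstruction_of_congruence (h₁ : exists_isNewformOf)
    (hDS : ∀ (N : ℕ) [NeZero N] (k : ℤ), 12 ≤ k → DeligneSerre1974_span_integralLattice1 N k)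
    (hC : ∀ (N : ℕ) [NeZero N] (f : CuspForm (Gamma0 N) 2), IsNewform0 f → coeffField f = ⊥ →
      ∀ (L : PeriodPair), L.lattice.toAddSubgroup = periodLattice f →
        ∀ a₄ a₆ : ℚ, L.g₂ = -4 * (a₄ : ℂ) → L.g₃ = -4 * (a₆ : ℂ) →
          ∀ p : ℕ, p.Prime → ¬ p ∣ N →
            (qExpansion 1 ⇑f).coeff p =
              (({ a₁ := 0, a₂ := 0, a₃ := 0, a₄ := a₄, a₆ := a₆ } : WeierstrassCurve ℚ).LFunction
                p : ℂ)) :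
    eichlerShimuraConstruction :=
  eichlerShimuraConstruction_of_rational_invariants h₁ (rational_invariants_of_congruence hDS hC)

/-- **Knapp's Thm. 11.74 (d)–(e) with the rational Manin constant from (2.7.2) and the
congruence relation**: for every newform `f ∈ S₂(Γ₀(N))` with `K_f = ℚ` an elliptic `W/ℚ` with
`a_p(W) = a_p(f)` for `p ∤ N` and a Néron-type period pair `L` of `W` with `Λ_L = c • Λ_f`,
`c ∈ ℚ`, `c ≠ 0` (here `W = y² = x³ + a₄x + a₆`, `c = 1`; `strongWeil_of_rational_invariants`).
[cite: Knapp1993, Thm. 11.74 (d), (e) with Remarks (PDF p. 287) and PDF p. 302] -/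
theorem strongWeil_of_congruence
    (hDS : ∀ (N : ℕ) [NeZero N] (k : ℤ), 12 ≤ k → DeligneSerre1974_span_integralLattice1 N k)
    (hC : ∀ (N : ℕ) [NeZero N] (f : CuspForm (Gamma0 N) 2), IsNewform0 f → coeffField f = ⊥ →
      ∀ (L : PeriodPair), L.lattice.toAddSubgroup = periodLattice f →
        ∀ a₄ a₆ : ℚ, L.g₂ = -4 * (a₄ : ℂ) → L.g₃ = -4 * (a₆ : ℂ) →
          ∀ p : ℕ, p.Prime → ¬ p ∣ N →
            (qExpansion 1 ⇑f).coeff p =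
              (({ a₁ := 0, a₂ := 0, a₃ := 0, a₄ := a₄, a₆ := a₆ } : WeierstrassCurve ℚ).LFunction
                p : ℂ))
    (N : ℕ) [NeZero N] (f : CuspForm (Gamma0 N) 2) (hf : IsNewform0 f) (hQ : coeffField f = ⊥) :
    ∃ W : WeierstrassCurve ℚ, W.IsElliptic ∧
      (∀ p : ℕ, p.Prime → ¬ p ∣ N → (qExpansion 1 ⇑f).coeff p = (W.LFunction p : ℂ)) ∧
        ∃ (L : PeriodPair) (c : ℚ), IsNeronLatticeOf (W.baseChange ℂ) L ∧ c ≠ 0 ∧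
          (L.lattice : Set ℂ) = (c : ℂ) • (periodLattice f : Set ℂ) :=
  strongWeil_of_rational_invariants (rational_invariants_of_congruence hDS hC) N f hf hQ

/-! ### The named fact from (2.7.2), the congruence relation and Faltings -/

/-- **`IsNewformOf.exists_maninConstant_ne_zero` from (2.7.2), the congruence relation at the
primes `p ∤ N`, and Faltings' isogeny theorem** (`rational_invariants_of_congruence` with
`exists_maninConstant_ne_zero_of_rational_invariants`): the printed "(2) ⇒ (6)" with Shimura's
construction carried out analytically in the tree up to the congruence relation.
[cite: BCDTJAMS2001, p. 845, "(2) ⇒ (6)"] [cite: Knapp1993, Thm. 11.74 (e) with Remarks (PDF p. 287)] -/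
theorem exists_maninConstant_ne_zero_of_congruence
    (hDS : ∀ (N : ℕ) [NeZero N] (k : ℤ), 12 ≤ k → DeligneSerre1974_span_integralLattice1 N k)
    (hC : ∀ (N : ℕ) [NeZero N] (f : CuspForm (Gamma0 N) 2), IsNewform0 f → coeffField f = ⊥ →
      ∀ (L : PeriodPair), L.lattice.toAddSubgroup = periodLattice f →
        ∀ a₄ a₆ : ℚ, L.g₂ = -4 * (a₄ : ℂ) → L.g₃ = -4 * (a₆ : ℂ) →
          ∀ p : ℕ, p.Prime → ¬ p ∣ N →
            (qExpansion 1 ⇑f).coeff p =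
              (({ a₁ := 0, a₂ := 0, a₃ := 0, a₄ := a₄, a₆ := a₆ } : WeierstrassCurve ℚ).LFunction
                p : ℂ))
    (hF : WeierstrassCurve.isIsogenous_iff_frobeniusTrace_eq) :
    IsNewformOf.exists_maninConstant_ne_zero :=
  exists_maninConstant_ne_zero_of_rational_invariants (rational_invariants_of_congruence hDS hC) hF

/-- **`IsNewformOf.exists_maninConstant_ne_zero` from (2.7.2), the *cofinite* congruence
relation, and Faltings.** Hypothesis `hC` is the congruence relation in the form Shimura prints
(1971, Thm. 7.15: the zeta function of the abelian variety attached to `f` "coincides, up to a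
finite number of Euler factors, with" `L(s, f)`), for the model `y² = x³ + a₄x + a₆`,
`(-4a₄, -4a₆) = (g₂(L), g₃(L))`, of `ℂ/Λ_f`: `a_p(f) = a_p(y² = x³ + a₄x + a₆)` for all but
finitely many primes `p`. Proof, for `IsNewformOf W f` and a Néron-type `L` of `W`: `K_f = ℚ`
(`IsNewformOf.coeffField_eq_bot_of_isNewformOf`); a period pair `L_f` spans `Λ_f`
(`IsNewform0.exists_periodPair_of_coeffField_eq_bot`, Shimura Thm. 7.14); `a₄, a₆ ∈ ℚ` by
`IsNewform0.exists_rat_g₂_g₃_periodLattice` and `hDS`; the short model `E` is elliptic with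
Néron-type lattice `Λ_f` (`isElliptic_shortModel`, `isNeronLatticeOf_shortModel`); `a_p(E) =
a_p(f) = a_p(W)` off a finite set, so `E ~ W` over `ℚ`
(`WeierstrassCurve.isIsogenous_of_finite_setOf_LFunction_ne`, Faltings); and `ℚ`-isogenous
curves have commensurable Néron lattices (`neronLattice_commensurable_of_isIsogenous_holds`):
`a Λ_f ⊆ Λ_L`, `a ∈ ℤ ∖ {0}`.
[cite: BCDTJAMS2001, p. 845, "(2) ⇒ (6)"] [cite: ShimuraIATAF1971, Thm. 7.14 and Thm. 7.15 (PDF p. 212)]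
[cite: Faltings1983Endlichkeit, §5 Korollar 2 (i) ⟺ (iii)] -/
theorem exists_maninConstant_ne_zero_of_congruence_cofinite
    (hDS : ∀ (N : ℕ) [NeZero N] (k : ℤ), 12 ≤ k → DeligneSerre1974_span_integralLattice1 N k)
    (hC : ∀ (N : ℕ) [NeZero N] (f : CuspForm (Gamma0 N) 2), IsNewform0 f → coeffField f = ⊥ →
      ∀ (L : PeriodPair), L.lattice.toAddSubgroup = periodLattice f →
        ∀ a₄ a₆ : ℚ, L.g₂ = -4 * (a₄ : ℂ) → L.g₃ = -4 * (a₆ : ℂ) →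
          {p : ℕ | p.Prime ∧ (qExpansion 1 ⇑f).coeff p ≠
            (({ a₁ := 0, a₂ := 0, a₃ := 0, a₄ := a₄, a₆ := a₆ } : WeierstrassCurve ℚ).LFunction
              p : ℂ)}.Finite)
    (hF : WeierstrassCurve.isIsogenous_iff_frobeniusTrace_eq) :
    IsNewformOf.exists_maninConstant_ne_zero := by
  intro W _ N _ f hf L hL
  have hQ : coeffField f = ⊥ := hf.coeffField_eq_bot_of_isNewformOf
  obtain ⟨Lf, hLf⟩ := hf.1.exists_periodPair_of_coeffField_eq_bot hQ
  obtain ⟨a₄, a₆, h₂, h₃⟩ := hf.1.exists_rat_g₂_g₃_periodLattice hQ Lf hLf (hDS N)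
  haveI := isElliptic_shortModel h₂ h₃
  have hiso : WeierstrassCurve.IsIsogenous
      ({ a₁ := 0, a₂ := 0, a₃ := 0, a₄ := a₄, a₆ := a₆ } : WeierstrassCurve ℚ) W := by
    refine WeierstrassCurve.isIsogenous_of_finite_setOf_LFunction_ne hF _ W
      ((hC N f hf.1 hQ Lf hLf a₄ a₆ h₂ h₃).subset ?_)
    rintro p ⟨hp, hne⟩
    refine ⟨hp, fun h ↦ hne ?_⟩
    have h' := h.symm.trans (hf.2 p)
    exact_mod_cast h'
  obtain ⟨a, ha0, ha⟩ :=
    neronLattice_commensurable_of_isIsogenous_holds hiso (isNeronLatticeOf_shortModel h₂ h₃) hL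
  refine ⟨a, ha0, fun z hz ↦ ha z ?_⟩
  rw [← hLf] at hz
  exact hz

/-- The congruence relation at the primes `p ∤ N` implies its cofinite form (the exceptional
set is contained in the prime divisors of `N`). [folklore] -/
theorem setOf_coeff_ne_finite_of_forall_not_dvd {N : ℕ} [NeZero N] {f : CuspForm (Gamma0 N) 2}
    {E : WeierstrassCurve ℚ}
    (h : ∀ p : ℕ, p.Prime → ¬ p ∣ N → (qExpansion 1 ⇑f).coeff p = (E.LFunction p : ℂ)) :
    {p : ℕ | p.Prime ∧ (qExpansion 1 ⇑f).coeff p ≠ (E.LFunction p : ℂ)}.Finite := by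
  refine N.primeFactors.finite_toSet.subset ?_
  rintro p ⟨hp, hne⟩
  refine (Nat.mem_primeFactors_of_ne_zero (NeZero.ne N)).mpr ⟨hp, ?_⟩
  by_contra hpN
  exact hne (h p hp hpN)

/-- Consistency check: the `p ∤ N` assembly is also an instance of the cofinite one
(`setOf_coeff_ne_finite_of_forall_not_dvd`). [folklore] -/
theorem exists_maninConstant_ne_zero_of_congruence'
    (hDS : ∀ (N : ℕ) [NeZero N] (k : ℤ), 12 ≤ k → DeligneSerre1974_span_integralLattice1 N k)
    (hC : ∀ (N : ℕ) [NeZero N] (f : CuspForm (Gamma0 N) 2), IsNewform0 f → coeffField f = ⊥ →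
      ∀ (L : PeriodPair), L.lattice.toAddSubgroup = periodLattice f →
        ∀ a₄ a₆ : ℚ, L.g₂ = -4 * (a₄ : ℂ) → L.g₃ = -4 * (a₆ : ℂ) →
          ∀ p : ℕ, p.Prime → ¬ p ∣ N →
            (qExpansion 1 ⇑f).coeff p =
              (({ a₁ := 0, a₂ := 0, a₃ := 0, a₄ := a₄, a₆ := a₆ } : WeierstrassCurve ℚ).LFunction
                p : ℂ))
    (hF : WeierstrassCurve.isIsogenous_iff_frobeniusTrace_eq) :
    IsNewformOf.exists_maninConstant_ne_zero :=
  exists_maninConstant_ne_zero_of_congruence_cofinite hDS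
    (fun N _ f hf hQ L hL a₄ a₆ h₂ h₃ ↦
      setOf_coeff_ne_finite_of_forall_not_dvd (hC N f hf hQ L hL a₄ a₆ h₂ h₃)) hF

end Literature.NumberTheory.EllipticCurves.ModularForms

end
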